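import Summits.ResolutionOfSingularities.ResolutionOfSingularities.Theorems.PurelyInseparableDim4PointStepChart
import Mathlib.Algebra.CharP.Reduced
import HarnessLib

/-!
# Purely inseparable four-folds: the INDUCTION STEP of the point-centre walk on an arbitrary ambient — every closed
# order-`p` point over the blown-up point is an Edge AND carries a chart (brick TY-3j part 3 «STEP PACKAGE», cell `res-dim4-pi`)

[OURS · counted 0] (D-0157 DOOR 2; the re-usable induction step of the depth-`n` / ISOLATED-regime assembly of
`PIDim4.TerminationImpliesOrderReduction` (typ-3 memo §C); host item stmt-ResolutionOfSingularities-16155, helper).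
Nothing here proves resolution of singularities in dimension ≥ 4 / characteristic `p`.

Data («INVARIANT»): `Z` locally Noetherian, `φ : 𝔸⁵_K ⟶ Z` an open-immersion chart at the closed point `x₀ = φ(ξ)`, a
marked ideal `M` of multiplicity `p` with `M.ideal.comap φ = (z^p + F)·𝒪`, `F ≠ 0` clean with `p ≤ ord₀ F`; `K`
algebraically closed of characteristic `p`; `π : W → Z` ANY blowing up of `x₀`; `M' = M.transform π 𝓘_{x₀}`.

* `specMap_algEquiv_ξ_asIdeal` — the re-centring automorphism `Θ` (`Θ z = z + h(x)`, `Θ xᵢ = xᵢ + bᵢ`) sends the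
  origin to the rational point `(h(0), b)`: `((Spec Θ) ξ).asIdeal = 𝔪_{(h(0), b)}`;
* `constantCoeff_pow_add_eq_zero_of_chart` — for the chart `φ' = Spec Θ ≫ chartImm_j ≫ ι` of part 2, `h(0)` IS the
  `p`-th root: `h(0)^p + F′_j(b) = 0` (the model `(z^p + s′.F)·𝒪` has order `≥ 1` at the origin);
* **`point_step_package`** — for every CLOSED `w ∈ W` over `x₀` with `ord_w M' ≥ p`: there are `j`, `b` with `b_j = 0`,
  an EDGE `PIDim4.Edge p univ s (step p univ j b s)`, and an open-immersion chart `φ' : 𝔸⁵_K ⟶ W` with `φ'(ξ) = w` and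
  `M'.ideal.comap φ' = hypSheaf p (step p univ j b s).F` — the INVARIANT again, at `w`, for the walk's next state.
  (Closed order-`p` points NOT over `x₀` are untouched: `IsBlowup.idealOrder_controlledTransform_eq_of_not_mem`.)

What remains for the ISO depth-`n` theorem: chaining `IsMultipleBlowup.blowup` at closed points (admissible for every snc
boundary: tree `isRegular_subscheme_vanishingIdeal_singleton`, `HasSNC.hasSNCWith_vanishingIdeal_singleton`) under a
finiteness hypothesis on the closed order-`p` points at each stage, and the stop condition of `…ClosedPoints`.
AI-produced formalisation, weaker than expert review. bears_on: LADDER-RESOLUTION:D157-DOOR2 (res-dim4-pi · TY-3j).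
-/

set_option linter.dupNamespace false -- D-0017: single-problem summit path `Summit.<S>.<S>.…` by design

noncomputable section

open MvPolynomial Finset CategoryTheory AlgebraicGeometry Opposite TopologicalSpace

namespace Summit.ResolutionOfSingularities.ResolutionOfSingularities.Theorems.PIDim4

open Literature.AlgebraicGeometry.Resolution
open Literature.AlgebraicGeometry.Resolution.Hauser2010
open Literature.AlgebraicGeometry.Resolution.AffinePointBlowup (P A γ coord Wtop ξ)

namespace Equimultiple

section Package

variable {K : Type} [Field K] {p : ℕ} [hp : Fact p.Prime] [CharP K p]
variable {Z W : Scheme.{0}} {π : W ⟶ Z} {x₀ : Z}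

omit hp [CharP K p] in
/-- **The re-centring automorphism on points**: for `Θ` with `Θ z = z + h(x)` and `Θ xᵢ = xᵢ + bᵢ`, the point
`(Spec Θ)(ξ)` of `𝔸⁵_K` is the rational point `(h(0), b)`. [folklore] -/
theorem specMap_algEquiv_ξ_asIdeal (Θ : A 4 K ≃ₐ[K] A 4 K) (h : MvPolynomial (Fin 4) K) (b : Fin 4 → K)
    (h0 : Θ (X 0) = X 0 + rename Fin.succ h) (hs : ∀ i : Fin 4, Θ (X i.succ) = X i.succ + C (b i)) :
    ((Spec.map (CommRingCat.ofHom (Θ : A 4 K →+* A 4 K))) (ξ 4 K)).asIdeal =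
      MvPolynomial.vanishingIdeal K {(Fin.cons (constantCoeff h) b : Fin (4 + 1) → K)} := by
  -- the two ring maps `constantCoeff ∘ Θ` and `eval (h(0), b)` agree on generators
  have key : constantCoeff.comp (Θ : A 4 K →+* A 4 K) =
      MvPolynomial.eval (Fin.cons (constantCoeff h) b : Fin (4 + 1) → K) := by
    refine MvPolynomial.ringHom_ext (fun r => ?_) (fun i => ?_)
    · rw [RingHom.comp_apply, eval_C, show (Θ : A 4 K →+* A 4 K) (C r) = Θ (C r) from rfl,
        show Θ (C r) = C r from Θ.commutes r, constantCoeff_C]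
    · rw [RingHom.comp_apply, eval_X, show (Θ : A 4 K →+* A 4 K) (X i) = Θ (X i) from rfl]
      refine Fin.cases ?_ (fun k => ?_) i
      · rw [h0, map_add, constantCoeff_X, zero_add, constantCoeff_rename, Fin.cons_zero]
      · rw [hs k, map_add, constantCoeff_X, zero_add, constantCoeff_C, Fin.cons_succ]
  ext g
  rw [Spec.map_apply, PrimeSpectrum.comap_asIdeal, Ideal.mem_comap, CommRingCat.hom_ofHom,
    MvPolynomial.mem_vanishingIdeal_singleton_iff]
  change constantCoeff ((Θ : A 4 K →+* A 4 K) g) = 0 ↔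
    MvPolynomial.eval (Fin.cons (constantCoeff h) b : Fin (4 + 1) → K) g = 0
  rw [← RingHom.comp_apply, key]

omit hp [CharP K p] in
/-- The constant term of `z^p + G(x)` is that of `G`. [folklore] -/
theorem constantCoeff_hyp (hp0 : p ≠ 0) (G : MvPolynomial (Fin 4) K) : constantCoeff (hyp p G) = constantCoeff G := by
  rw [hyp, map_add, map_pow, constantCoeff_X, zero_pow hp0, zero_add, constantCoeff_rename]

/-- **The cleaning constant is the `p`-th root.** In the setting of part 2 (`exists_chart_step`), for the explicit chart
`φ' = Spec Θ ≫ chartImm_j ≫ (π⁻¹V).ι` the rational point `(h(0), b)` lies on `V(z^p + F′_j)`: `h(0)^p + F′_j(b) = 0` (the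
model `(z^p + (step …).F)·𝒪` carried by `φ'` has order `≥ 1` at the origin, since the step polynomial has no constant
term). [cite: HauserPerlega2019PRIMS, §2 (cleaning z ↦ z − F(b)^{1/p}·…)] -/
theorem constantCoeff_pow_add_eq_zero_of_chart [IsLocallyNoetherian Z] [DecidableEq K] (hx₀ : IsClosed ({x₀} : Set Z))
    {V : Z.Opens} (hx₀V : x₀ ∈ V) (e : (V : Scheme.{0}) ≅ P 4 K) (hex₀ : e.hom.base ⟨x₀, hx₀V⟩ = ξ 4 K)
    (s : State K) (hperm : (p : ℕ∞) ≤ CentreBlowup.ordAlong (Finset.univ : Finset (Fin 4)) s.F)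
    (hπ : IsBlowup π (Scheme.IdealSheafData.vanishingIdeal (⟨{x₀}, hx₀⟩ : Closeds Z))) (j : Fin 4) (b : Fin 4 → K)
    (Θ : A 4 K ≃ₐ[K] A 4 K) (h : MvPolynomial (Fin 4) K) (h0 : Θ (X 0) = X 0 + rename Fin.succ h)
    (hs : ∀ i : Fin 4, Θ (X i.succ) = X i.succ + C (b i))
    (hc : (controlledTransform ((π ∣_ V) ≫ e.hom)
        (AffineCoordBlowup.𝓘Λ 4 K (insert 0 (Fin.succ '' ((Finset.univ : Finset (Fin 4)) : Set (Fin 4)))))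
        (hypSheaf p s.F) p).comap (Spec.map (CommRingCat.ofHom (Θ : A 4 K →+* A 4 K)) ≫
          AffineCoordBlowup.chartImm (isBlowup_chart hx₀ hx₀V e hex₀ hπ)
            (ChartDictionary.succ_mem_centreVars (Finset.mem_univ j))) =
      hypSheaf p (CentreBlowup.step p Finset.univ j b s).F) :
    constantCoeff h ^ p + MvPolynomial.eval b (CentreBlowup.chartTransform p Finset.univ j s.F) = 0 := by
  haveI := isOpenImmersion_specMap_algEquiv Θ
  have hπV := isBlowup_chart hx₀ hx₀V e hex₀ hπ
  -- (1) the cleaned model has order `≥ 1` at the origin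
  have hcons : (Fin.cons (0 : K) (0 : Fin 4 → K) : Fin (4 + 1) → K) = 0 := funext fun i => Fin.cases rfl (fun _ => rfl) i
  have hξ : (ξ 4 K).asIdeal = MvPolynomial.vanishingIdeal K {(Fin.cons 0 0 : Fin (4 + 1) → K)} := by
    change originIdeal K (4 + 1) = _
    ext g
    rw [mem_originIdeal_iff, MvPolynomial.mem_vanishingIdeal_singleton_iff, hcons, MvPolynomial.aeval_zero]
    exact Iff.rfl
  have h1 : (1 : ℕ∞) ≤ idealOrder (hypSheaf p (CentreBlowup.step p Finset.univ j b s).F) (ξ 4 K) := by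
    have h := natCast_le_idealOrder_hypSheaf_iff (p := p) (CentreBlowup.step p Finset.univ j b s).F hξ 1
    rw [Nat.cast_one] at h
    rw [h, hcons, PointBlowup.translate_zero, one_le_ordZero_iff, constantCoeff_hyp hp.out.ne_zero]
    show coeff 0 (deletePthPowers p (CentreBlowup.pointTransform p Finset.univ j b s)) = 0
    rw [coeff_deletePthPowers, if_pos (show IsPthPowerExponent p (0 : Fin 4 →₀ ℕ) from fun i hi => by simp at hi)]
  -- (2) read it at the rational point `(h(0), b)` of the `x_j`-chart
  have h2 : (1 : ℕ∞) ≤ ordZero (PointBlowup.translate (Fin.cons (constantCoeff h) b : Fin (4 + 1) → K)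
      (hyp p (CentreBlowup.chartTransform p Finset.univ j s.F))) := by
    have h3 := natCast_le_idealOrder_hypSheaf_iff (p := p) (CentreBlowup.chartTransform p Finset.univ j s.F)
      (specMap_algEquiv_ξ_asIdeal Θ h b h0 hs) 1
    rw [Nat.cast_one] at h3
    rw [← hc, Scheme.IdealSheafData.comap_comp, idealOrder_comap_of_isOpenImmersion,
      ChartDictionary.controlledTransform_comap_chartImm p (Finset.mem_univ j) s.F hperm
        (isBlowup_chart hx₀ hx₀V e hex₀ hπ), h3] at h1
    exact h1
  rw [translate_hyp, one_le_ordZero_iff, map_add, map_add, map_pow, constantCoeff_X, zero_pow hp.out.ne_zero,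
    zero_add, constantCoeff_C, constantCoeff_rename] at h2
  rwa [show constantCoeff (PointBlowup.translate b (CentreBlowup.chartTransform p Finset.univ j s.F)) =
      MvPolynomial.eval b (CentreBlowup.chartTransform p Finset.univ j s.F) from coeff_zero_translate b _] at h2

/-- **THE STEP PACKAGE (point centre, arbitrary ambient).** Under the INVARIANT at `(Z, M, x₀)` (see the module
docstring) and for ANY blowing up `π : W → Z` of `x₀`: every CLOSED point `w` of `W` over `x₀` at which the transformed
marked ideal has order `≥ p` comes from an EDGE `Edge p univ s (step p univ j b s)` of the point-centre walk
(`j : Fin 4`, `b_j = 0`), and the INVARIANT holds again at `(W, M.transform π 𝓘_{x₀}, w)` with the next state: there is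
an open-immersion chart `φ' : 𝔸⁵_K ⟶ W`, `φ'(ξ) = w`, `(M.transform π 𝓘_{x₀}).ideal.comap φ' =
hypSheaf p (step p univ j b s).F`. [cite: Hauser2010, §F (equiconstant points)]
[cite: BierstoneGrigorievMilmanWlodarczyk2011, §3.2 and Lemma 8.0.3 (2)] -/
theorem point_step_package [IsLocallyNoetherian Z] [IsAlgClosed K] [DecidableEq K] (φ : P 4 K ⟶ Z)
    [IsOpenImmersion φ] (hx₀ : IsClosed ({x₀} : Set Z)) (hφ : φ (ξ 4 K) = x₀) (M : MarkedIdeal Z)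
    (hmult : M.mult = p) (s : State K) (hM : M.ideal.comap φ = hypSheaf p s.F) (hF : s.F ≠ 0)
    (hclean : Literature.Barriers.ResolutionOfSingularities.HauserPerlega.IsClean p s.F)
    (hperm : (p : ℕ∞) ≤ CentreBlowup.ordAlong (Finset.univ : Finset (Fin 4)) s.F)
    (hπ : IsBlowup π (Scheme.IdealSheafData.vanishingIdeal (⟨{x₀}, hx₀⟩ : Closeds Z))) {w : W}
    (hw : IsClosed ({w} : Set W)) (hwx : π w = x₀)
    (hord : (p : ℕ∞) ≤ idealOrder
      (M.transform π (Scheme.IdealSheafData.vanishingIdeal (⟨{x₀}, hx₀⟩ : Closeds Z))).ideal w) :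
    ∃ (j : Fin 4) (b : Fin 4 → K), b j = 0 ∧ Edge p Finset.univ s (CentreBlowup.step p Finset.univ j b s) ∧
      ∃ (φ' : P 4 K ⟶ W) (_ : IsOpenImmersion φ'), φ' (ξ 4 K) = w ∧
        (M.transform π (Scheme.IdealSheafData.vanishingIdeal (⟨{x₀}, hx₀⟩ : Closeds Z))).ideal.comap φ' =
          hypSheaf p (CentreBlowup.step p Finset.univ j b s).F := by
  -- the `(V, e)` dress and the blow-up over the chart
  have hx₀V : x₀ ∈ φ.opensRange := mem_opensRange_of_eq φ hφ
  set V : Z.Opens := φ.opensRange with hV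
  let e : (V : Scheme.{0}) ≅ P 4 K := φ.isoOpensRange.symm
  have hex₀ : e.hom.base ⟨x₀, hx₀V⟩ = ξ 4 K := isoOpensRange_inv_apply φ hφ
  have hM' : (M.ideal.comap V.ι).comap e.inv = hypSheaf p s.F := by rw [comap_comap_isoOpensRange φ M.ideal, hM]
  have hπV := isBlowup_chart hx₀ hx₀V e hex₀ hπ
  set M' := M.transform π (Scheme.IdealSheafData.vanishingIdeal (⟨{x₀}, hx₀⟩ : Closeds Z)) with hM'def
  set I' := controlledTransform ((π ∣_ V) ≫ e.hom)
      (AffineCoordBlowup.𝓘Λ 4 K (insert 0 (Fin.succ '' ((Finset.univ : Finset (Fin 4)) : Set (Fin 4)))))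
      (hypSheaf p s.F) p with hI'
  have hres : M'.ideal.comap (π ⁻¹ᵁ V).ι = I' := by
    rw [hM'def, comap_transform_ideal_restrict hx₀ hx₀V e hex₀ M s hM' hπ, hmult]
  -- `w` as a point of `π⁻¹V`
  have hwV : w ∈ π ⁻¹ᵁ V := by
    change π w ∈ V
    rw [hwx]
    exact hx₀V
  set wt : (π ⁻¹ᵁ V : Scheme.{0}) := ⟨w, hwV⟩ with hwt
  have hιw : (π ⁻¹ᵁ V).ι wt = w := rfl
  have hwt_closed : IsClosed ({wt} : Set (π ⁻¹ᵁ V : Scheme.{0})) := by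
    have hpre : ((π ⁻¹ᵁ V).ι : (π ⁻¹ᵁ V : Scheme.{0}) → W) ⁻¹' {w} = {wt} := by
      ext z
      simp only [Set.mem_preimage, Set.mem_singleton_iff]
      constructor
      · intro hz
        exact (π ⁻¹ᵁ V).ι.isOpenEmbedding.injective (hz.trans hιw.symm)
      · rintro rfl
        exact hιw
    rw [← hpre]
    exact hw.preimage (π ⁻¹ᵁ V).ι.continuous
  have hordt : (p : ℕ∞) ≤ idealOrder I' wt := by
    rw [← hres, idealOrder_comap_of_isOpenImmersion (π ⁻¹ᵁ V).ι M'.ideal wt, hιw]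
    exact hord
  -- the point lies in some `x_j`-chart of `πV`
  obtain ⟨j, hj, hwj⟩ := exists_mem_opensRange_chartImm_succ_of_le_idealOrder (p := p) s.F hperm hπV hordt
  obtain ⟨x, a, b, hxw, hx, hab, heq⟩ := (le_idealOrder_iff_of_isClosed_of_mem_range
    (AffineCoordBlowup.chartImm hπV (ChartDictionary.succ_mem_centreVars hj)) I' Finset.univ j s
    (ChartDictionary.controlledTransform_comap_chartImm p hj s.F hperm hπV) hwt_closed hwj).mp hordt
  -- over `x₀` means on the exceptional hyperplane: `b_j = 0`
  have hbj : b j = 0 := by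
    rw [← X_succ_mem_asIdeal_iff j a b hx, ← π_chartImm_mem_CΛ_iff hπV hj x, hxw]
    have h1 : (π ∣_ V) wt = ⟨x₀, hx₀V⟩ := by
      apply Subtype.ext
      change ((π ∣_ V) wt).1 = x₀
      have h2 : V.ι ((π ∣_ V) wt) = π ((π ⁻¹ᵁ V).ι wt) := by
        rw [← Scheme.Hom.comp_apply, ← Scheme.Hom.comp_apply, morphismRestrict_ι]
      have h3 : (V.ι ((π ∣_ V) wt) : Z) = ((π ∣_ V) wt).1 := rfl
      rw [← h3, h2, hιw, hwx]
    rw [Scheme.Hom.comp_apply, h1, hex₀, centreVars_univ, AffineCoordBlowup.CΛ_univ]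
    rfl
  refine ⟨j, b, hbj, edge_step_of_isEquimultiplePoint s hF hclean ⟨Finset.univ_nonempty, hperm⟩
    (Finset.mem_univ j) hbj heq, ?_⟩
  -- the new chart at `w`
  obtain ⟨Θ, h, h0, hs, hc⟩ :=
    ChartDictionary.controlledTransform_chart_eq_step p hj hbj s hperm hπV
  haveI := isOpenImmersion_specMap_algEquiv Θ
  have hroot := constantCoeff_pow_add_eq_zero_of_chart hx₀ hx₀V e hex₀ s hperm hπ j b Θ h h0 hs hc
  -- `h(0) = a`: both are `p`-th roots of `-F′_j(b)`
  have hca : constantCoeff h = a := by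
    apply frobenius_inj K p
    rw [frobenius_def, frobenius_def]
    have e1 := eq_neg_of_add_eq_zero_left hroot
    have e2 := eq_neg_of_add_eq_zero_left hab
    rw [e1, e2]
  have hpt : (Spec.map (CommRingCat.ofHom (Θ : A 4 K →+* A 4 K))) (ξ 4 K) = x := by
    apply PrimeSpectrum.ext
    rw [specMap_algEquiv_ξ_asIdeal Θ h b h0 hs, hca, hx]
  refine ⟨(Spec.map (CommRingCat.ofHom (Θ : A 4 K →+* A 4 K)) ≫
      AffineCoordBlowup.chartImm hπV (ChartDictionary.succ_mem_centreVars hj)) ≫ (π ⁻¹ᵁ V).ι,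
    inferInstance, ?_, ?_⟩
  · rw [Scheme.Hom.comp_apply, Scheme.Hom.comp_apply, hpt, hxw]
    exact hιw
  · rw [Scheme.IdealSheafData.comap_comp, hres]
    exact hc

end Package

end Equimultiple

end Summit.ResolutionOfSingularities.ResolutionOfSingularities.Theorems.PIDim4

end
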